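import Summits.KontsevichZagierPeriods.Zeta5Search.LaiSweepShard

/-!
# `κ₃` sweep certificate — shard file 006 of 127 (shards 42–48 of 889)

HONEST FRAMING. Systematic search; no irrationality claim unless certified. This file only checks,
by `decide +kernel`, shards 42–48 of the order-cell sweep of the `κ₃` point `(74, 2180, 444; δ74)`
(engine `LaiSweepEngine`, soundness `LaiSweepJump/Free/Eval/Shard/Kappa3`; a shard is `⟨regime, n,
p, q, p', q', Lo, Up⟩`: `n` cells from `p/q` to `p'/q'` with integer rate sums in `[Lo, Up]`, `K =
128`, `D = 2^40`). It draws NO conclusion: only the capstone `LaiKappa3SweepCert`, which needs all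
127 shard files, does. Kernel cost of this file ≈ 560 cells × 0.3 s.
-/

namespace Summit.KontsevichZagierPeriods.Zeta5Search.Sweep

set_option maxHeartbeats 100000000 in
/-- Shard 42: 80 cells of regime A from `31/2534` to `7/564`.
[cite: Lai2024BallRivoal, §4 Lemma 4.3] -/
theorem shard042 :
    Shard.check 128 (2^40)
      ⟨false, 80, 31, 2534, 7, 564, 104991319451026, 105026208043705⟩ = true := by
  decide +kernel

set_option maxHeartbeats 100000000 in
/-- Shard 43: 80 cells of regime A from `7/564` to `11/867`.
[cite: Lai2024BallRivoal, §4 Lemma 4.3] -/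
theorem shard043 :
    Shard.check 128 (2^40)
      ⟨false, 80, 7, 564, 11, 867, 152395171968082, 152468757910280⟩ = true := by
  decide +kernel

set_option maxHeartbeats 100000000 in
/-- Shard 44: 80 cells of regime A from `11/867` to `31/2402`.
[cite: Lai2024BallRivoal, §4 Lemma 4.3] -/
theorem shard044 :
    Shard.check 128 (2^40)
      ⟨false, 80, 11, 867, 31, 2402, 115469404872063, 115516476199458⟩ = true := by
  decide +kernel

set_option maxHeartbeats 100000000 in
/-- Shard 45: 80 cells of regime A from `31/2402` to `15/1142`.
[cite: Lai2024BallRivoal, §4 Lemma 4.3] -/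
theorem shard045 :
    Shard.check 128 (2^40)
      ⟨false, 80, 31, 2402, 15, 1142, 115695613834786, 115742979813924⟩ = true := by
  decide +kernel

set_option maxHeartbeats 100000000 in
/-- Shard 46: 80 cells of regime A from `15/1142` to `35/2613`.
[cite: Lai2024BallRivoal, §4 Lemma 4.3] -/
theorem shard046 :
    Shard.check 128 (2^40)
      ⟨false, 80, 15, 1142, 35, 2613, 127563667770457, 127618509971080⟩ = true := by
  decide +kernel

set_option maxHeartbeats 100000000 in
/-- Shard 47: 80 cells of regime A from `35/2613` to `15/1099`.
[cite: Lai2024BallRivoal, §4 Lemma 4.3] -/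
theorem shard047 :
    Shard.check 128 (2^40)
      ⟨false, 80, 35, 2613, 15, 1099, 120675996046013, 120726086771733⟩ = true := by
  decide +kernel

set_option maxHeartbeats 100000000 in
/-- Shard 48: 80 cells of regime A from `15/1099` to `35/2522`.
[cite: Lai2024BallRivoal, §4 Lemma 4.3] -/
theorem shard048 :
    Shard.check 128 (2^40)
      ⟨false, 80, 15, 1099, 35, 2522, 107578022207193, 107617970998168⟩ = true := by
  decide +kernel

/-- The checked shards of this file, in order. [folklore] -/
def shards006 : List (CheckedShard 128 (2^40)) :=
  [⟨_, shard042⟩, ⟨_, shard043⟩, ⟨_, shard044⟩, ⟨_, shard045⟩, ⟨_, shard046⟩,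
    ⟨_, shard047⟩, ⟨_, shard048⟩]

end Summit.KontsevichZagierPeriods.Zeta5Search.Sweep
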